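import Summits.Ventures.YMGap.RobustBall.UniformPlaquetteVarianceFloor
import Summits.Ventures.YMGap.RobustBall.SummableOneLink
import Summits.Ventures.YMGap.RobustBall.LoopActionMember
import HarnessLib

/-!
# Venture YMGap, track ROBUST-BALL (Y2) — the plaquette-fluctuation FLOOR on the TIER-2 (weighted, infinite-range) ball and on the
# loop-action norm ball, at EVERY coupling

HONEST FRAMING. WHAT THIS IS: a venture file (cell `pub-ymgap`, track Y2 ROBUST-BALL, seat rb-p1, theorems only), the tier-2 twin of
`UniformPlaquetteVarianceFloor.lean`: for every member `W` of the weighted ball `MemBallZdS a Λ t` (summable infinite-range potentials with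
oscillation load `a`), every 't Hooft coupling `β`, every DLR state `μ` of `perturbedYMS (fundamentalRep (Fin N)) (Nβ) W` and every plaquette,
`Var_μ(W_p) ≥ e^{−(4(d−1)N²|β| + a)} · V₀/N²` (`variance_plaquette_ge_of_memBallZdS`; the one-link law of the summable member is Haar tilted by
`perturbedEnergyS`, whose oscillation in the link is `≤ 4(d−1)N²|β| + a` by `tsum_through_update_osc`). In particular for EVERY generic
Wilson-type loop action with finite carrier fibres and `‖c‖_w ≤ ε` (a member of `MemBallZdS (2ε) ε w`, rb-p1's `memBallZdS_loopFamilyAction`):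
`Var_μ(W_p) ≥ e^{−(4(d−1)N²|β| + 2ε)} · V₀/N²` (`variance_plaquette_ge_loopFamilyAction`); `SU(2)`, `d = 4`:
`Var_μ(½ Re tr U_p) ≥ e^{−(12|β_W| + 2ε)}/4` (`su2_variance_plaquette_ge_loopBall`). No smallness of `β` or `ε` is needed.
WHAT THIS IS NOT: a lattice statement at every coupling; nothing about the continuum or Clay.
-/

noncomputable section

open MeasureTheory Filter Function ProbabilityTheory Real
open scoped NNReal
open Literature.Probability.LatticeModels
open Literature.Probability.LatticeModels.DobrushinMetric
open Literature.MathematicalPhysics.QuantumLattice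
open Literature.MathematicalPhysics.QuantumFieldTheory hiding ZdEdge Site

namespace Summit.Ventures.YMGap.RobustBall

variable {d N : ℕ}

section Member

variable {β a Λ t : ℝ} {W : Potential (ZdEdge d) (SUN N)}

/-- **Oscillation of the summable member's one-link energy**: for `W ∈ MemBallZdS a Λ t` at 't Hooft `β`, the tilt
`g ↦ perturbedEnergyS (Nβ) W {e} (ω^{e←g})` varies by at most `4(d−1)N²|β| + a`. [folklore] -/
theorem perturbedEnergyS_singleton_osc (hd : 1 ≤ d) (hW : MemBallZdS a Λ t W) (e : ZdEdge d) (ω : LGConfig d (SUN N))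
    (g g' : SUN N) :
    perturbedEnergyS (fundamentalRep (Fin N)) (N * β) W {e} (Function.update ω e g) ≤
      perturbedEnergyS (fundamentalRep (Fin N)) (N * β) W {e} (Function.update ω e g') +
        (4 * ((d : ℝ) - 1) * (N : ℝ) ^ 2 * |β| + a) := by
  obtain ⟨B, hB⟩ := hW.summable
  obtain ⟨osc, lip, ℓ, hosc, -, hoscs, hosca, -, -, -, -⟩ := hW.loads
  have hu := fundamentalRep_mem_unitaryGroup (n := Fin N)
  have hH := tsum_through_update_osc hB hosc e (hoscs e) (hosca e) ω g' g
  unfold perturbedEnergyS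
  rw [tsum_inter_singleton_eq W e, tsum_inter_singleton_eq W e,
    wilsonBoundaryAction_singleton_update (fundamentalRep (Fin N)) hu e ω g,
    wilsonBoundaryAction_singleton_update (fundamentalRep (Fin N)) hu e ω g', Finset.sum_sub_distrib, Finset.sum_sub_distrib]
  have hS := PlaquettePositivity.abs_sum_re_trace_staple_le (fundamentalRep (Fin N)) hu e ω g
  have hS' := PlaquettePositivity.abs_sum_re_trace_staple_le (fundamentalRep (Fin N)) hu e ω g'
  have hcard : ((plaquettesTouching {e}).card : ℝ) ≤ 2 * ((d : ℝ) - 1) := by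
    have h := card_plaquettesTouching_singleton_le e
    have h' : ((plaquettesTouching {e}).card : ℝ) ≤ ((2 * (d - 1) : ℕ) : ℝ) := by exact_mod_cast h
    rw [Nat.cast_mul, Nat.cast_sub hd] at h'
    simpa using h'
  have hN0 : (0 : ℝ) ≤ N := Nat.cast_nonneg _
  have hdiff : |(N * β) * (∑ p ∈ plaquettesTouching {e}, (fundamentalRep (Fin N) g * fundamentalRep (Fin N) (staple p e ω)).trace.re -
      ∑ p ∈ plaquettesTouching {e}, (fundamentalRep (Fin N) g' * fundamentalRep (Fin N) (staple p e ω)).trace.re)| ≤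
      4 * ((d : ℝ) - 1) * (N : ℝ) ^ 2 * |β| := by
    rw [abs_mul, abs_mul, Nat.abs_cast]
    have h2 : |∑ p ∈ plaquettesTouching {e}, (fundamentalRep (Fin N) g * fundamentalRep (Fin N) (staple p e ω)).trace.re -
        ∑ p ∈ plaquettesTouching {e}, (fundamentalRep (Fin N) g' * fundamentalRep (Fin N) (staple p e ω)).trace.re| ≤
        2 * (2 * ((d : ℝ) - 1) * N) := by
      refine (abs_sub _ _).trans ?_
      have := mul_le_mul_of_nonneg_right hcard hN0
      linarith
    calc (N : ℝ) * |β| * _ ≤ (N : ℝ) * |β| * (2 * (2 * ((d : ℝ) - 1) * N)) := by gcongr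
      _ = 4 * ((d : ℝ) - 1) * (N : ℝ) ^ 2 * |β| := by ring
  have hlin := (abs_le.1 hdiff).1
  have hlin' := (abs_le.1 hdiff).2
  nlinarith [hH, hlin, hlin']

/-- **THE UNIFORM VARIANCE FLOOR ON THE TIER-2 BALL, EVERY COUPLING**: for `d ≥ 2`, `N ≥ 2`, any 't Hooft `β`, every member `W` of
`MemBallZdS a Λ t`, every DLR state `μ` of the summable member and every plaquette:
`Var_μ(W_p) ≥ e^{−(4(d−1)N²|β| + a)} · V₀/N²`. [folklore] -/
theorem variance_plaquette_ge_of_memBallZdS (hd : 2 ≤ d) (hN : 2 ≤ N) (hW : MemBallZdS a Λ t W)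
    {μ : Measure (LGConfig d (SUN N))} (hμ : μ ∈ perturbedGibbsMeasuresS (d := d) (fundamentalRep (Fin N)) (N * β) W)
    (p : ZdPlaquette d) :
    Real.exp (-(4 * ((d : ℝ) - 1) * (N : ℝ) ^ 2 * |β| + a)) * (PlaquetteLowerBound.charVariance (fundamentalRep (Fin N)) / (N : ℝ) ^ 2) ≤
      Var[zdPlaquetteObs (fundamentalRep (Fin N)) p.1 p.2.1.1 p.2.1.2; μ] := by
  classical
  haveI : SecondCountableTopology (Matrix (Fin N) (Fin N) ℂ) := inferInstanceAs (SecondCountableTopology (Fin N → Fin N → ℂ))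
  haveI : SecondCountableTopology (SUN N) := Topology.IsEmbedding.subtypeVal.secondCountableTopology
  have hd1 : 1 ≤ d := by omega
  have hρc : Continuous (fundamentalRep (Fin N)) := continuous_fundamentalRep (Fin N)
  obtain ⟨B, hB⟩ := hW.summable
  have hγ : IsSpecification (perturbedYMS (d := d) (fundamentalRep (Fin N)) (N * β) W) :=
    isSpecification_perturbedYMS _ hρc _ hB hW.continuous hW.dependsOn
  have hμ' : IsGibbsMeasure (perturbedYMS (d := d) (fundamentalRep (Fin N)) (N * β) W) μ := hμ
  haveI := hμ'.isProbabilityMeasure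
  set F : LGConfig d (SUN N) → ℝ := zdPlaquetteObs (fundamentalRep (Fin N)) p.1 p.2.1.1 p.2.1.2 with hF
  have hFm : Measurable F := (isLipschitzCylinder_zdPlaquetteObs p.1 p.2.2).measurable
  have hF1 : ∀ U, |F U| ≤ 1 := fun U => abs_zdPlaquetteObs_le fundamentalRep_mem_unitaryGroup _ _ _ U
  set m : ℝ := ∫ U, F U ∂μ with hm
  have hm1 : |m| ≤ 1 := by
    have h := norm_integral_le_of_norm_le_const (μ := μ) (f := F) (C := 1) (ae_of_all _ fun U => by
      rw [Real.norm_eq_abs]; exact hF1 U)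
    simpa [Real.norm_eq_abs] using h
  set X : LGConfig d (SUN N) → ℝ := fun U => (F U - m) ^ 2 with hX
  have hXm : Measurable X := (hFm.sub measurable_const).pow_const 2
  have hX0 : ∀ U, 0 ≤ X U := fun U => sq_nonneg _
  have hX4 : ∀ U, X U ≤ 4 := fun U => by
    have h1 := hF1 U
    have : |F U - m| ≤ 2 := (abs_sub _ _).trans (by linarith)
    calc X U = |F U - m| ^ 2 := by rw [hX, sq_abs]
      _ ≤ 2 ^ 2 := pow_le_pow_left₀ (abs_nonneg _) this 2
      _ = 4 := by norm_num
  have hXabs : ∀ U, |X U| ≤ 4 := fun U => by rw [abs_of_nonneg (hX0 U)]; exact hX4 U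
  rw [variance_eq_integral hFm.aemeasurable]
  change _ ≤ ∫ U, X U ∂μ
  set e : ZdEdge d := (p.1, p.2.1.1) with he
  have hep : e ∈ plaquetteEdges p := by simp [he, plaquetteEdges]
  refine PlaquettePositivity.le_integral_of_isGibbsMeasure hγ hμ' {e} hXm hXabs fun η => ?_
  change _ ≤ siteAvg (perturbedYMS (d := d) (fundamentalRep (Fin N)) (N * β) W) e X η
  rw [siteAvg_eq_integral_siteLaw hγ e hXm η, siteLaw_perturbedYMS_eq_tilted_haar _ hρc _ hB hW.continuous e η]
  set D : ℝ := 4 * ((d : ℝ) - 1) * (N : ℝ) ^ 2 * |β| + a with hD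
  set φ : SUN N → ℝ := fun g => perturbedEnergyS (fundamentalRep (Fin N)) (N * β) W {e} (Function.update η e g) with hφ
  have hφm : Measurable φ :=
    (continuous_perturbedEnergyS _ hρc _ hB hW.continuous {e}).measurable.comp (measurable_update η)
  obtain ⟨lo, hlo⟩ := exists_window_of_osc (1 : SUN N) (V := φ) (a := D)
    (fun g g' => perturbedEnergyS_singleton_osc hd1 hW e η g g')
  have hXup : Measurable fun g : SUN N => X (Function.update η e g) := hXm.comp (measurable_update η)
  have htilt := PlaquettePositivity.exp_neg_mul_integral_le_integral_tilted (ν := haarProbability (SUN N)) hXup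
    (fun g => hX0 _) (fun g => hX4 _) hφm (a := lo) (D := D) (ae_of_all _ fun g => hlo g)
  refine le_trans ?_ htilt
  exact mul_le_mul_of_nonneg_left (integral_haar_sq_sub_ge hN hep η m) (Real.exp_nonneg _)

end Member

/-! ### The loop-action norm ball -/

/-- **VARIANCE FLOOR ON THE LOOP-ACTION NORM BALL, EVERY COUPLING**: for `d ≥ 2`, `N ≥ 2`, every generic Wilson-type loop action
`loopFamilyAction N γ c` with finite carrier fibres and `‖c‖_w ≤ ε`, every 't Hooft `β`, every DLR state, every plaquette:
`Var_μ(W_p) ≥ e^{−(4(d−1)N²|β| + 2ε)} · V₀/N²` (the action lies in `MemBallZdS (2ε) ε w`, rb-p1's `memBallZdS_loopFamilyAction`). [folklore] -/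
theorem variance_plaquette_ge_loopFamilyAction (hd : 2 ≤ d) (hN : 2 ≤ N) {ι : Type*} {γ : ι → ZdLoop d} {c : ι → ℝ} {w ε β : ℝ}
    (hfin : ∀ X, {i | walkEdges (γ i).walk = X}.Finite) (hn : LoopNormLE w γ c ε)
    {μ : Measure (LGConfig d (SUN N))}
    (hμ : μ ∈ perturbedGibbsMeasuresS (d := d) (fundamentalRep (Fin N)) (N * β) (loopFamilyAction (d := d) N γ c))
    (p : ZdPlaquette d) :
    Real.exp (-(4 * ((d : ℝ) - 1) * (N : ℝ) ^ 2 * |β| + 2 * ε)) * (PlaquetteLowerBound.charVariance (fundamentalRep (Fin N)) / (N : ℝ) ^ 2) ≤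
      Var[zdPlaquetteObs (fundamentalRep (Fin N)) p.1 p.2.1.1 p.2.1.2; μ] :=
  variance_plaquette_ge_of_memBallZdS hd hN (memBallZdS_loopFamilyAction hfin hn) hμ p

/-- **`SU(2)`, `d = 4`, the loop ball, every coupling**: every loop action with finite carrier fibres and `‖c‖_w ≤ ε`, every DLR state, every
plaquette: `Var_μ(½ Re tr U_p) ≥ e^{−(12|β_W| + 2ε)}/4`. [folklore] -/
theorem su2_variance_plaquette_ge_loopBall {ι : Type*} {γ : ι → ZdLoop 4} {c : ι → ℝ} {w ε βW : ℝ}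
    (hfin : ∀ X, {i | walkEdges (γ i).walk = X}.Finite) (hn : LoopNormLE w γ c ε) {μ : Measure (LGConfig 4 (SUN 2))}
    (hμ : μ ∈ perturbedGibbsMeasuresS (d := 4) (fundamentalRep (Fin 2)) (2 * (βW / 4)) (loopFamilyAction (d := 4) 2 γ c))
    (p : ZdPlaquette 4) :
    Real.exp (-(12 * |βW| + 2 * ε)) / 4 ≤ Var[zdPlaquetteObs (fundamentalRep (Fin 2)) p.1 p.2.1.1 p.2.1.2; μ] := by
  have h := variance_plaquette_ge_loopFamilyAction (d := 4) (N := 2) (by norm_num) (by norm_num) hfin hn hμ p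
  rw [HaarSecondMoments.charVariance_su2] at h
  have e1 : (4 * (((4 : ℕ) : ℝ) - 1) * ((2 : ℕ) : ℝ) ^ 2 * |βW / 4| + 2 * ε) = 12 * |βW| + 2 * ε := by
    rw [abs_div, abs_of_pos (by norm_num : (0 : ℝ) < 4)]; push_cast; ring
  have e2 : (1 : ℝ) / ((2 : ℕ) : ℝ) ^ 2 = 1 / 4 := by norm_num
  rw [e1, e2] at h
  rw [div_eq_mul_one_div]
  exact h

end Summit.Ventures.YMGap.RobustBall

end
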